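import Summits.Ventures.PercRepro.ExcessOneNonTightening
import Summits.Ventures.PercRepro.MSTightBadExtension

/-!
# The extension lemma: the partner family at a non-tightening direction

Dossier proofs/MINE1-theoremS.md, Addendum 53, Steps 4 and 5 of the proof of Theorem (E).
`K` is a family, `e` a non-tightening direction with nonempty partner family `K' = partner e K`
(so Theorem (NT) applies: `K'` is tight, `diffsY e K = K' \\ K' = flip R K'` with
`R = Rstar K'`, every `s ∈ part0 e K` has `s ∩ R ∈ K'`, every `s ∈ partr e K` has
`s ∪ R ∈ K'`), and `t` is a bad set (`t \ k ∈ K \\ K` for all members, `t` below no member)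
containing the core of `K` and avoiding `e`, such that `insert t (proj e K)` is tight, `t.erase g`
lies in the projection for every `g ∈ t` outside the core (MaxErase), and the only twin of an
element of `t` outside the core in `insert t (proj e K)` is itself. Then:

* `inter_Rstar_mem_partner_of_bad`: `t ∩ R ∈ K'`, and `R.erase g ∈ K'` for every `g ∈ t ∩ R`
  outside the core (the twin-closure of the flip of `K'`);
* `sdiff_mem_diffsY_of_bad`: `k₁ \ t ∈ diffsY e K` for every `k₁ ∈ partr e K` (a case analysis
  on a twin pair separating `k₁ \ t` from the flip member `(k₁ ∪ R) \ (t ∩ R)`).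
-/

namespace PercRepro.MSTight

open Finset
open scoped FinsetFamily symmDiff

variable {α : Type*} [DecidableEq α]

/-- The symmetric difference with `R` of a subset of `R` is the complement inside `R`. -/
theorem symmDiff_eq_sdiff_of_subset {A R : Finset α} (h : A ⊆ R) : A ∆ R = R \ A := by
  ext x
  simp only [mem_symmDiff, mem_sdiff]
  constructor
  · rintro (⟨hxA, hxR⟩ | ⟨hxR, hxA⟩)
    · exact absurd (h hxA) hxR
    · exact ⟨hxR, hxA⟩
  · rintro ⟨hxR, hxA⟩
    exact Or.inr ⟨hxR, hxA⟩

/-- From `A ∆ R = B ∆ R` conclude `A = B`. -/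
theorem eq_of_symmDiff_eq {A B R : Finset α} (h : A ∆ R = B ∆ R) : A = B := by
  have h' := congrArg (fun S => S ∆ R) h
  simpa only [symmDiff_symmDiff_cancel_right] using h'

/-- A bad set `t` contains, together with any member `R`, an element of `R` outside the core:
otherwise `t \ R` is a difference `a \ b` and `t ⊆ a`. -/
theorem exists_mem_inter_notMem_core_of_bad {K : Finset (Finset α)} {t R : Finset α}
    (ht : ∀ k ∈ K, t \ k ∈ K \\ K) (hnot : ∀ k ∈ K, ¬ t ⊆ k) (hRK : R ∈ K) :
    ∃ g ∈ t ∩ R, ∃ k ∈ K, g ∉ k := by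
  by_contra h
  push Not at h
  obtain ⟨a, ha, b, -, hab⟩ := mem_diffs.1 (ht R hRK)
  refine hnot a ha fun x hx => ?_
  by_cases hxR : x ∈ R
  · exact h x (mem_inter.2 ⟨hx, hxR⟩) a ha
  · have hx' : x ∈ t \ R := mem_sdiff.2 ⟨hx, hxR⟩
    rw [← hab] at hx'
    exact (mem_sdiff.1 hx').1

variable [Fintype α]

/-- **Step 4.** `t ∩ Rstar K' ∈ K'`, and `(Rstar K').erase g ∈ K'` for every `g ∈ t ∩ Rstar K'`
outside the core. -/
theorem inter_Rstar_mem_partner_of_bad {K : Finset (Finset α)} {e : α} {t : Finset α}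
    (hε : (diffsX e K ∩ diffsY e K).card = (partner e K).card) (hK'ne : (partner e K).Nonempty)
    (het : e ∉ t) (hcore : ∀ a, (∀ k ∈ K, a ∈ k) → a ∈ t) (ht : ∀ k ∈ K, t \ k ∈ K \\ K)
    (hnot : ∀ k ∈ K, ¬ t ⊆ k) (hTQ : Tight (insert t (proj e K)))
    (htwQ : ∀ a b, a ∈ t → (∃ k ∈ K, a ∉ k) → Twin (insert t (proj e K)) a b → b = a)
    (herase : ∀ g ∈ t, (∃ k ∈ K, g ∉ k) → t.erase g ∈ proj e K) :
    t ∩ Rstar (partner e K) ∈ partner e K ∧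
      ∀ g ∈ t ∩ Rstar (partner e K), (∃ k ∈ K, g ∉ k) →
        (Rstar (partner e K)).erase g ∈ partner e K := by
  set Q := proj e K with hQ
  set K' := partner e K with hK'
  set R := Rstar K' with hR
  have hK'tight : Tight K' := (tight_partner_of_card_eq hε).1
  have hYeq : diffsY e K = K' \\ K' := diffsY_eq_diffs_partner_of_nonTightening hε hK'ne
  have hRK' : R ∈ K' := Rstar_partner_mem hε hK'ne
  have hflip : K' \\ K' = flip R K' := diffs_eq_flip_of_tight hK'tight
  have hdich := dichotomy_of_tight hK'tight
  have hK'sub : K' ⊆ K := fun k hk => mem_of_mem_partner hk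
  have hK'part0 : K' ⊆ part0 e K := fun k hk => (mem_inter.1 hk).1
  have hRK : R ∈ K := hK'sub hRK'
  have hmem2a : ∀ s ∈ part0 e K, s ∩ R ∈ K' := fun s hs => inter_Rstar_mem_partner hε hK'ne hs
  have hmem2b : ∀ s ∈ partr e K, s ∪ R ∈ K' := fun s hs => union_Rstar_mem_partner hε hK'ne hs
  have hpart0Q : part0 e K ⊆ Q := by
    rw [hQ, proj_eq_union]
    exact subset_union_left
  have hnotQ : ∀ q ∈ Q, ¬ t ⊆ q := by
    intro q hq hsub
    obtain ⟨k, hk, rfl⟩ := mem_proj.1 hq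
    exact hnot k hk (hsub.trans (erase_subset e k))
  set q := t ∩ R with hq
  have hqR : q ⊆ R := inter_subset_right
  have hqt : q ⊆ t := inter_subset_left
  -- `t.erase g ∈ part0 e K` and `q.erase g ∈ K'` for `g ∈ q` outside the core
  have hteg0 : ∀ g ∈ q, (∃ k ∈ K, g ∉ k) → t.erase g ∈ part0 e K := by
    intro g hgq hgout
    have hgR : g ∈ R := (mem_inter.1 hgq).2
    have hteg' := herase g (hqt hgq) hgout
    rw [hQ, proj_eq_union] at hteg'
    rcases mem_union.1 hteg' with h | h
    · exact h
    · exfalso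
      have h1 := hmem2b _ h
      refine hnot _ (hK'sub h1) fun x hx => mem_union.2 ?_
      by_cases hxg : x = g
      · exact Or.inr (hxg ▸ hgR)
      · exact Or.inl (mem_erase.2 ⟨hxg, hx⟩)
  have hqg : ∀ g ∈ q, (∃ k ∈ K, g ∉ k) → q.erase g ∈ K' := by
    intro g hgq hgout
    have h1 := hmem2a _ (hteg0 g hgq hgout)
    have e1 : t.erase g ∩ R = q.erase g := by
      ext x
      simp only [mem_inter, mem_erase, hq]
      tauto
    rwa [e1] at h1
  -- `{g} ∈ flip R K'` forces `R.erase g ∈ K'`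
  have hsingflip : ∀ g ∈ R, ({g} : Finset α) ∈ flip R K' → R.erase g ∈ K' := by
    intro g hgR h
    obtain ⟨A, hA, hAg⟩ := mem_flip.1 h
    have e1 : A = R.erase g := by
      apply eq_of_symmDiff_eq (R := R)
      rw [hAg]
      ext x
      simp only [mem_symmDiff, mem_erase, mem_singleton]
      constructor
      · rintro rfl
        exact Or.inr ⟨hgR, fun h => h.1 rfl⟩
      · rintro (⟨⟨hxg, hxR⟩, hxR'⟩ | ⟨hxR, hx⟩)
        · exact absurd hxR hxR'
        · by_contra hxg
          exact hx ⟨hxg, hxR⟩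
    rw [← e1]
    exact hA
  have hqsing : ∀ g ∈ q, q \ q.erase g = {g} := by
    intro g hgq
    ext x
    simp only [mem_sdiff, mem_erase, mem_singleton, not_and]
    constructor
    · rintro ⟨hxq, hx⟩
      by_contra hxg
      exact hx hxg hxq
    · rintro rfl
      exact ⟨hgq, fun h _ => h rfl⟩
  -- the element `g`
  obtain ⟨g, hgq, hgout⟩ := exists_mem_inter_notMem_core_of_bad ht hnot hRK
  have hgt : g ∈ t := (mem_inter.1 hgq).1
  have hgR : g ∈ R := (mem_inter.1 hgq).2
  have hqg' : q.erase g ∈ K' := hqg g hgq hgout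
  -- `q ∈ insert t Q` by convexity on twin-closed sets, hence `q ∈ Q`
  have htcq : TwinClosed (insert t Q) q := by
    intro a b hab ha
    have hat : a ∈ t := hqt ha
    by_cases haout : ∃ k ∈ K, a ∉ k
    · rw [htwQ a b hat haout hab]
      exact ha
    · push Not at haout
      have hae : a ≠ e := fun h => het (h ▸ hat)
      have hball : ∀ k ∈ K, b ∈ k := by
        intro k hk
        have h1 := hab (k.erase e) (mem_insert_of_mem (mem_proj.2 ⟨k, hk, rfl⟩))
        exact mem_of_mem_erase (h1.1 (mem_erase.2 ⟨hae, haout k hk⟩))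
      exact mem_inter.2 ⟨hcore b hball, hball R hRK⟩
  have hqT : q ∈ insert t Q :=
    mem_of_subset_of_subset_of_twinClosed_of_tight hTQ
      (mem_insert_of_mem (hpart0Q (hK'part0 hqg'))) (mem_insert_self t Q) (erase_subset g q) hqt htcq
  have hqQ : q ∈ Q := by
    rcases mem_insert.1 hqT with h | h
    · exfalso
      exact hnot R hRK (h ▸ hqR)
    · exact h
  -- the main claim `q ∈ K'`
  have hqK' : q ∈ K' := by
    by_cases hq0 : q ∈ part0 e K
    · have := hmem2a q hq0
      rwa [inter_eq_left.2 hqR] at this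
    · exfalso
      have hq1 : q ∈ partr e K := by
        have hqQ' := hqQ
        rw [hQ, proj_eq_union] at hqQ'
        exact (mem_union.1 hqQ').resolve_left hq0
      have hgY : ({g} : Finset α) ∈ diffsY e K := by
        rw [← hqsing g hgq]
        exact mem_diffs.2 ⟨q, hq1, q.erase g, hK'part0 hqg', rfl⟩
      rw [hYeq, hflip] at hgY
      have hRg : R.erase g ∈ K' := hsingflip g hgR hgY
      have hZg : R \ q ∪ {g} ∈ flip R K' := by
        have h1 := symmDiff_mem_flip (M := R) hqg'
        rw [symmDiff_eq_sdiff_of_subset ((erase_subset g q).trans hqR)] at h1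
        have e2 : R \ q.erase g = R \ q ∪ {g} := by
          ext x
          simp only [mem_sdiff, mem_erase, mem_union, mem_singleton, not_and]
          constructor
          · rintro ⟨hxR, hx⟩
            by_cases hxg : x = g
            · exact Or.inr hxg
            · exact Or.inl ⟨hxR, fun hxq => hx hxg hxq⟩
          · rintro (⟨hxR, hxq⟩ | rfl)
            · exact ⟨hxR, fun _ h => hxq h⟩
            · exact ⟨hgR, fun h _ => h rfl⟩
        rwa [e2] at h1
      have hZ : R \ q ∉ flip R K' := by
        intro h
        obtain ⟨A', hA', hA'q⟩ := mem_flip.1 h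
        have : A' = q := by
          apply eq_of_symmDiff_eq (R := R)
          rw [hA'q, symmDiff_eq_sdiff_of_subset hqR]
        exact hq0 (hK'part0 (this ▸ hA'))
      have hntc : ¬ TwinClosed K' (R \ q) := fun htc =>
        hZ (mem_flip_of_subset_of_twinClosed hdich hZg subset_union_left htc)
      unfold TwinClosed at hntc
      push Not at hntc
      obtain ⟨a, b, hab, haZ, hbZ⟩ := hntc
      have hbZg : b ∈ R \ q ∪ {g} := twinClosed_of_mem_flip hZg a b hab (mem_union_left _ haZ)
      have hbg : b = g := by
        rcases mem_union.1 hbZg with h | h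
        · exact absurd h hbZ
        · exact mem_singleton.1 h
      have ha' : a ∈ R.erase g :=
        mem_erase.2 ⟨fun h => (mem_sdiff.1 haZ).2 (h ▸ hgq), (mem_sdiff.1 haZ).1⟩
      have hb' := (hab _ hRg).1 ha'
      rw [hbg] at hb'
      exact (notMem_erase g R) hb'
  refine ⟨hqK', ?_⟩
  intro g' hg'q hg'out
  apply hsingflip g' (mem_inter.1 hg'q).2
  rw [← hflip, ← hqsing g' hg'q]
  exact mem_diffs.2 ⟨q, hqK', q.erase g', hqg g' hg'q hg'out, rfl⟩

/-- **Step 5.** `k₁ \ t ∈ diffsY e K` for every `k₁ ∈ partr e K`. -/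
theorem sdiff_mem_diffsY_of_bad {K : Finset (Finset α)} {e : α} {t : Finset α}
    (hε : (diffsX e K ∩ diffsY e K).card = (partner e K).card) (hK'ne : (partner e K).Nonempty)
    (htf : ∀ a b, (∃ k ∈ K, a ∈ k) → (∃ k ∈ K, a ∉ k) → (∃ k ∈ K, b ∈ k) → (∃ k ∈ K, b ∉ k) →
      Twin K a b → a = b)
    (hcore : ∀ a, (∀ k ∈ K, a ∈ k) → a ∈ t)
    (hqK' : t ∩ Rstar (partner e K) ∈ partner e K)
    (hRg : ∃ g ∈ t, (Rstar (partner e K)).erase g ∈ partner e K) :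
    ∀ k₁ ∈ partr e K, k₁ \ t ∈ diffsY e K := by
  set K' := partner e K with hK'
  set R := Rstar K' with hR
  obtain ⟨g, hgt, hRg⟩ := hRg
  have hK'tight : Tight K' := (tight_partner_of_card_eq hε).1
  have hYeq : diffsY e K = K' \\ K' := diffsY_eq_diffs_partner_of_nonTightening hε hK'ne
  have hRK' : R ∈ K' := Rstar_partner_mem hε hK'ne
  have hflip : K' \\ K' = flip R K' := diffs_eq_flip_of_tight hK'tight
  have hdich := dichotomy_of_tight hK'tight
  have hK'part0 : K' ⊆ part0 e K := fun k hk => (mem_inter.1 hk).1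
  have hmem2b : ∀ s ∈ partr e K, s ∪ R ∈ K' := fun s hs => union_Rstar_mem_partner hε hK'ne hs
  set q := t ∩ R with hq
  have hqt : q ⊆ t := inter_subset_left
  have hYtc : ∀ W ∈ diffsY e K, TwinClosed K' W := by
    intro W hW
    rw [hYeq, hflip] at hW
    exact twinClosed_of_mem_flip hW
  intro k₁ hk₁
  have hk₁R : k₁ ∪ R ∈ K' := hmem2b k₁ hk₁
  have hM : (k₁ ∪ R) \ q ∈ flip R K' := by
    rw [← hflip]
    exact mem_diffs.2 ⟨_, hk₁R, _, hqK', rfl⟩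
  have hSM : k₁ \ t ⊆ (k₁ ∪ R) \ q := by
    intro x hx
    rw [mem_sdiff] at hx ⊢
    exact ⟨mem_union_left _ hx.1, fun h => hx.2 (hqt h)⟩
  rw [hYeq, hflip]
  by_contra hS
  have hntc : ¬ TwinClosed K' (k₁ \ t) := fun htc =>
    hS (mem_flip_of_subset_of_twinClosed hdich hM hSM htc)
  unfold TwinClosed at hntc
  push Not at hntc
  obtain ⟨a, b, hab, haS, hbS⟩ := hntc
  have hbM : b ∈ (k₁ ∪ R) \ q := twinClosed_of_mem_flip hM a b hab (hSM haS)
  have hak₁ : a ∈ k₁ := (mem_sdiff.1 haS).1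
  have hat : a ∉ t := (mem_sdiff.1 haS).2
  by_cases hbk₁ : b ∈ k₁
  · -- case (ii): `b ∈ k₁`, so `b ∈ t` and `b ∉ R`
    have hbt : b ∈ t := by
      by_contra h
      exact hbS (mem_sdiff.2 ⟨hbk₁, h⟩)
    have hbR : b ∉ R := fun h => (mem_sdiff.1 hbM).2 (mem_inter.2 ⟨hbt, h⟩)
    by_cases haR : a ∈ R
    · have h1 : a ∈ R.erase g := mem_erase.2 ⟨fun h => hat (h ▸ hgt), haR⟩
      exact hbR (mem_of_mem_erase ((hab _ hRg).1 h1))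
    · have hsep : ∃ k ∈ K, ¬ (a ∈ k ↔ b ∈ k) := by
        by_contra h
        push Not at h
        have hab' : Twin K a b := fun k hk => h k hk
        have haout : ∃ k ∈ K, a ∉ k := by
          by_contra h'
          push Not at h'
          exact hat (hcore a h')
        have hkK : insert e k₁ ∈ K := (mem_partr.1 hk₁).2
        have hain : ∃ k ∈ K, a ∈ k := ⟨insert e k₁, hkK, mem_insert_of_mem hak₁⟩
        have hbin : ∃ k ∈ K, b ∈ k := ⟨insert e k₁, hkK, mem_insert_of_mem hbk₁⟩
        have hbout : ∃ k ∈ K, b ∉ k := by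
          obtain ⟨k, hk, hak⟩ := haout
          exact ⟨k, hk, fun hb => hak ((hab' k hk).2 hb)⟩
        have := htf a b hain haout hbin hbout hab'
        exact hbS (this ▸ haS)
      obtain ⟨k, hk, hk'⟩ := hsep
      have hae : a ≠ e := fun h => (mem_partr.1 hk₁).1 (h ▸ hak₁)
      have hbe : b ≠ e := fun h => (mem_partr.1 hk₁).1 (h ▸ hbk₁)
      by_cases hek : e ∈ k
      · have hke1 : k.erase e ∈ partr e K :=
          mem_partr.2 ⟨notMem_erase e k, by rwa [insert_erase hek]⟩
        have hW : k.erase e \ R ∈ diffsY e K :=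
          mem_diffs.2 ⟨_, hke1, R, hK'part0 hRK', rfl⟩
        have htc := hYtc _ hW
        apply hk'
        constructor
        · intro ha
          have h1 : a ∈ k.erase e \ R := mem_sdiff.2 ⟨mem_erase.2 ⟨hae, ha⟩, haR⟩
          exact (mem_erase.1 (mem_sdiff.1 (htc a b hab h1)).1).2
        · intro hb
          have h1 : b ∈ k.erase e \ R := mem_sdiff.2 ⟨mem_erase.2 ⟨hbe, hb⟩, hbR⟩
          exact (mem_erase.1 (mem_sdiff.1 (htc b a hab.symm h1)).1).2
      · have hW : k₁ \ k ∈ diffsY e K := mem_diffs.2 ⟨k₁, hk₁, k, mem_part0.2 ⟨hk, hek⟩, rfl⟩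
        have htc := hYtc _ hW
        apply hk'
        constructor
        · intro ha
          by_contra hb
          exact (mem_sdiff.1 (htc b a hab.symm (mem_sdiff.2 ⟨hbk₁, hb⟩))).2 ha
        · intro hb
          by_contra ha
          exact (mem_sdiff.1 (htc a b hab (mem_sdiff.2 ⟨hak₁, ha⟩))).2 hb
  · -- case (i): `b ∉ k₁`; `k₁ \ q ∈ Y` is twin-closed
    have hW : k₁ \ q ∈ diffsY e K := mem_diffs.2 ⟨k₁, hk₁, q, hK'part0 hqK', rfl⟩
    have htc := hYtc _ hW
    have h1 : a ∉ k₁ \ q := fun h => hbk₁ (mem_sdiff.1 (htc a b hab h)).1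
    have h2 : a ∈ q := by
      by_contra h
      exact h1 (mem_sdiff.2 ⟨hak₁, h⟩)
    exact hat (hqt h2)

end PercRepro.MSTight
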